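import Mathlib

/-! # First lemma of crux idea `riccati-sign-chain` (stmt-AtomisticToContinuum-17044), kernel-checked

Strategist seat s0 (planner-cstrat-stmt-AtomisticToContinuum-17044-0), 2026-08-17.  Mathlib only; rc 0, 0 sorries,
axioms {propext, Classical.choice, Quot.sound}.  `riccatiChainBound`: if `X ≻ 0` and the two Riccati inequalities
`A - X - C b * X⁻¹ * (C b)ᴴ ⪰ 0` (`b : Bool`) hold, the block-Jacobi chain form `Σₘ uₘ* A uₘ + 2 Re Σₘ uₘ* C(σ m) uₘ₊₁` is
nonnegative for EVERY sign word `σ` — the word-uniformity induction of the idea (apply to `A - ε•1` for ε-coercivity).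
Proof: Schur complement (`Matrix.PosDef.fromBlocks₂₂`) gives `[[A - X, C],[Cᴴ, X]] ⪰ 0`; evaluate on `(uₘ, uₘ₊₁)`, sum, telescope.
Not landed in Theorems/ (strategist remit); a prover may land it verbatim `--supports` the child-2 line. -/

open Matrix
open scoped ComplexOrder

namespace H21Scratch.RiccatiSignChain

section general
variable {ι : Type*} [Fintype ι]

/-- real part of a complex quadratic form -/
noncomputable def qf (M : Matrix ι ι ℂ) (x : ι → ℂ) : ℝ := (star x ⬝ᵥ M *ᵥ x).re

lemma re_nonneg_of_nonneg {z : ℂ} (h : 0 ≤ z) : 0 ≤ z.re := by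
  have := (Complex.le_def.1 h).1; simpa using this

lemma qf_nonneg_of_posSemidef {M : Matrix ι ι ℂ} (hM : M.PosSemidef) (x : ι → ℂ) : 0 ≤ qf M x :=
  re_nonneg_of_nonneg (hM.dotProduct_mulVec_nonneg x)

lemma qf_sub (M N : Matrix ι ι ℂ) (x : ι → ℂ) : qf (M - N) x = qf M x - qf N x := by
  simp [qf, sub_mulVec, dotProduct_sub]

/-- the cross term and its adjoint have the same real part -/
lemma re_cross (C : Matrix ι ι ℂ) (u v : ι → ℂ) :
    (star v ⬝ᵥ Cᴴ *ᵥ u).re = (star u ⬝ᵥ C *ᵥ v).re := by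
  rw [mulVec_conjTranspose, star_dotProduct_star, ← dotProduct_mulVec]
  simp

variable [DecidableEq ι]

/-- ONE STEP: the block matrix `[[A - X, C],[Cᴴ, X]]` is psd (Schur complement = the Riccati inequality),
evaluated on `(u, v)`. -/
lemma step {A X C : Matrix ι ι ℂ} (hX : X.PosDef)
    (hL : (A - X - C * X⁻¹ * Cᴴ).PosSemidef) (u v : ι → ℂ) :
    0 ≤ (qf A u - qf X u) + 2 * (star u ⬝ᵥ C *ᵥ v).re + qf X v := by
  letI : Invertible X := hX.isUnit.invertible
  have hB : (Matrix.fromBlocks (A - X) C Cᴴ X).PosSemidef :=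
    (Matrix.PosDef.fromBlocks₂₂ (A - X) C hX).mpr hL
  have h0 : 0 ≤ (star (Sum.elim u v) ⬝ᵥ (Matrix.fromBlocks (A - X) C Cᴴ X) *ᵥ (Sum.elim u v)).re :=
    re_nonneg_of_nonneg (hB.dotProduct_mulVec_nonneg (Sum.elim u v))
  have hexp : star (Sum.elim u v) ⬝ᵥ (Matrix.fromBlocks (A - X) C Cᴴ X) *ᵥ (Sum.elim u v)
      = (star u ⬝ᵥ (A - X) *ᵥ u + star u ⬝ᵥ C *ᵥ v) + (star v ⬝ᵥ Cᴴ *ᵥ u + star v ⬝ᵥ X *ᵥ v) := by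
    rw [Function.star_sumElim, fromBlocks_mulVec, sumElim_dotProduct_sumElim]
    simp only [Sum.elim_comp_inl, Sum.elim_comp_inr, dotProduct_add]
  rw [hexp] at h0
  simp only [Complex.add_re] at h0
  rw [re_cross C u v] at h0
  have e1 : (star u ⬝ᵥ (A - X) *ᵥ u).re = qf A u - qf X u := qf_sub A X u
  have e2 : (star v ⬝ᵥ X *ᵥ v).re = qf X v := rfl
  rw [e1, e2] at h0
  linarith

end general

/-- RICCATI CHAIN BOUND (first lemma of idea riccati-sign-chain), proved: two matrix inequalities
(`b = true / false`, the two registry classes) give nonnegativity of the block-Jacobi chain form for EVERY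
sign word `σ` and every displacement field supported in `{0,…,N}`. -/
theorem riccatiChainBound (n : ℕ) (A X : Matrix (Fin n) (Fin n) ℂ) (C : Bool → Matrix (Fin n) (Fin n) ℂ)
    (_hA : A.IsHermitian) (hX : X.PosDef)
    (hL : ∀ b : Bool, (A - X - C b * X⁻¹ * (C b)ᴴ).PosSemidef)
    (N : ℕ) (σ : ℕ → Bool) (u : ℕ → Fin n → ℂ) :
    0 ≤ (∑ m ∈ Finset.range (N + 1), (star (u m) ⬝ᵥ A.mulVec (u m)).re)
        + 2 * ∑ m ∈ Finset.range N, (star (u m) ⬝ᵥ (C (σ m)).mulVec (u (m + 1))).re := by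
  -- per-step inequalities
  have hstep : ∀ m, 0 ≤ (qf A (u m) - qf X (u m))
      + 2 * (star (u m) ⬝ᵥ (C (σ m)) *ᵥ (u (m + 1))).re + qf X (u (m + 1)) :=
    fun m => step hX (hL (σ m)) (u m) (u (m + 1))
  -- A - X is psd, hence the last site is paid for
  have hAX : (A - X).PosSemidef := by
    have h2 : (C true * X⁻¹ * (C true)ᴴ).PosSemidef :=
      hX.inv.posSemidef.mul_mul_conjTranspose_same (C true)
    simpa using (hL true).add h2
  have hlast : qf X (u N) ≤ qf A (u N) := by
    have := qf_nonneg_of_posSemidef hAX (u N); rw [qf_sub] at this; linarith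
  have hfirst : 0 ≤ qf X (u 0) := qf_nonneg_of_posSemidef hX.posSemidef (u 0)
  -- sum the steps over m < N and telescope the X-terms
  have hsum : 0 ≤ ∑ m ∈ Finset.range N, ((qf A (u m) - qf X (u m))
      + 2 * (star (u m) ⬝ᵥ (C (σ m)) *ᵥ (u (m + 1))).re + qf X (u (m + 1))) :=
    Finset.sum_nonneg (fun m _ => hstep m)
  have htel : ∑ m ∈ Finset.range N, (qf X (u (m + 1)) - qf X (u m)) = qf X (u N) - qf X (u 0) :=
    Finset.sum_range_sub (fun m => qf X (u m)) N
  have hre : ∑ m ∈ Finset.range N, ((qf A (u m) - qf X (u m))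
      + 2 * (star (u m) ⬝ᵥ (C (σ m)) *ᵥ (u (m + 1))).re + qf X (u (m + 1)))
      = (∑ m ∈ Finset.range N, qf A (u m))
        + 2 * (∑ m ∈ Finset.range N, (star (u m) ⬝ᵥ (C (σ m)) *ᵥ (u (m + 1))).re)
        + ∑ m ∈ Finset.range N, (qf X (u (m + 1)) - qf X (u m)) := by
    rw [Finset.mul_sum, ← Finset.sum_add_distrib, ← Finset.sum_add_distrib]
    exact Finset.sum_congr rfl (fun m _ => by ring)
  rw [hre, htel] at hsum
  have hsplit : ∑ m ∈ Finset.range (N + 1), (star (u m) ⬝ᵥ A.mulVec (u m)).re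
      = (∑ m ∈ Finset.range N, qf A (u m)) + qf A (u N) := by
    rw [Finset.sum_range_succ]; rfl
  rw [hsplit]
  change 0 ≤ (∑ m ∈ Finset.range N, qf A (u m)) + qf A (u N)
      + 2 * ∑ m ∈ Finset.range N, (star (u m) ⬝ᵥ (C (σ m)) *ᵥ (u (m + 1))).re
  linarith

/-- The statement filed on the idea card, discharged. -/
theorem riccatiChainBound_holds :
    (∀ (n : ℕ) (A X : Matrix (Fin n) (Fin n) ℂ) (C : Bool → Matrix (Fin n) (Fin n) ℂ),
      A.IsHermitian → X.PosDef →
      (∀ b : Bool, (A - X - C b * X⁻¹ * (C b)ᴴ).PosSemidef) →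
      ∀ (N : ℕ) (σ : ℕ → Bool) (u : ℕ → Fin n → ℂ),
        0 ≤ (∑ m ∈ Finset.range (N + 1), (star (u m) ⬝ᵥ A.mulVec (u m)).re)
            + 2 * ∑ m ∈ Finset.range N, (star (u m) ⬝ᵥ (C (σ m)).mulVec (u (m + 1))).re) :=
  fun n A X C hA hX hL N σ u => riccatiChainBound n A X C hA hX hL N σ u

end H21Scratch.RiccatiSignChain
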